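import Mathlib
import HarnessLib
import Summits.NavierStokesRegularity.NavierStokesRegularity.Theses.AxisTwistDoor

/-!
# AxisTwistDoor · crux `TiltDominationLoc` (stmt-NavierStokesRegularity-26991) — VOCABULARY of the skeleton of record
# and of the rigidity dictionary (route-posited objects, CONVENTIONS §1 `<RouteSlug>Defs.lean`)

Definitions only (no theorems).  The research crux `TiltDominationLoc` of route `AxisTwistDoor` (rank 2, XL; the ONLY
open item of the route after 2026-08-28T14:00Z) says: an energy-class Type-I ancient Oseen-mild profile with one-signed
vertical vorticity `ω₃ = ⟪curl v, e₃⟫ ≥ 0`, linear `e₃`-ball growth and a backward-singular apex is TILT-DOMINATED about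
the vertical axis through the apex on some parabolic neighbourhood of it (`∮|ω_h| dl ≤ K ∮ω₃ dl + M r`).

§1 restates VERBATIM the Props of the planner's birth skeleton (`Cruxes/TiltDominationLoc`, ns-idea-6 g3, ledger
skeleton sha `cbf45835…`; the planner's file is not importable from `Theorems/`), so that stubs can be landed and
cited BY NAME: `NeckBound`, `NonPlanarApex`, `StubNeckLength` (stub 1, PROVED: `…TiltDominationLoc.NeckLength.neckLength`,
p628658), `StubNoPlanarCollar` (stub 0, open), `StubApexTiltOfNeckLoc` (stub 2, open).

§2 names the three RIGIDITY statements of the dictionary proved in `…Theorems.AxisTwistDoorTiltDominationLocRigidity`: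
* `OneSignedRigidity` — no profile of the route's energy class with `ω₃ ≥ 0` and linear `e₃`-growth is backward-singular
  at the apex (= the antecedent of the route's support item `RotationToAxis`, verbatim; the one-signed Type-I Liouville
  statement of Lei–Ren–Tian arXiv:2501.08976 Remark 1.3, restricted to the Type-I energy class);
* `PoloidalRigidity` — no profile of the energy class with `ω₃ ≡ 0` on the whole backward slab is backward-singular at
  the apex (the energy-class restriction of the shared crux `FilamentPinchDoor.PoloidalWindowRigidity`, item 19708);
* `SingularIsPoloidal` — a backward-singular profile of the energy class with `ω₃ ≥ 0` (and linear growth) has `ω₃ ≡ 0`.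
There: `TiltDominationLoc ↔ OneSignedRigidity ↔ PoloidalRigidity ∧ SingularIsPoloidal ↔ StubNoPlanarCollar ∧
StubApexTiltOfNeckLoc`, `StubNoPlanarCollar ↔ PoloidalRigidity`, `StubApexTiltOfNeckLoc ↔ SingularIsPoloidal`.

WHAT THIS IS NOT: no theorem is proved here and none of these Props is asserted; `TiltDominationLoc`, the leaf
`HalfSpaceWindowDoor.Target` and Navier–Stokes regularity (Clay A) are OPEN.  Seat ns-atd-p1 (LEAD g3).
-/

noncomputable section

-- the summit and its single sub-problem share the name (CONVENTIONS §1), as in every Theorems file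
set_option linter.dupNamespace false

namespace Summit.NavierStokesRegularity.NavierStokesRegularity.Theorems.AxisTwistDoorTiltDominationLocDefs

open scoped BigOperators Topology MeasureTheory InnerProductSpace ENNReal
open Filter Set Function MeasureTheory Metric
open Summit.NavierStokesRegularity.NavierStokesRegularity.Theses.AxisTwistDoor

/-! ### §1 The birth skeleton's Props, verbatim -/

/-- NECK BOUND (birth skeleton, verbatim): the set of heights (within `R` of `z₀`) at which the circulation about the
vertical axis stays `≥ c` for all radii in `(ρ,R)` has length `≤ A·R/(c²·log(R/ρ))`. -/
def NeckBound (v : ℝ → EuclideanSpace ℝ (Fin 3) → EuclideanSpace ℝ (Fin 3)) : Prop :=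
  ∃ A : ℝ, 0 ≤ A ∧ ∀ s < 0, ∀ (c ρ R z₀ : ℝ), 0 < c → 0 < ρ → ρ < R →
    MeasureTheory.volume {z : ℝ | |z - z₀| < R ∧ ∀ r : ℝ, ρ < r → r < R → c ≤ ∫ θ in (0 : ℝ)..(2 * Real.pi), ⟪v s (WithLp.toLp 2 ![r * Real.cos θ, r * Real.sin θ, z] : EuclideanSpace ℝ (Fin 3)), (WithLp.toLp 2 ![-Real.sin θ, Real.cos θ, 0] : EuclideanSpace ℝ (Fin 3))⟫_ℝ * r}
      ≤ ENNReal.ofReal (A * R / (c ^ 2 * Real.log (R / ρ)))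

/-- NON-PLANAR APEX (birth skeleton, verbatim): every parabolic neighbourhood `{−δ² < s < 0, 0 < r < δ, |z| < δ}` of the
apex contains an axis circle with positive `ω₃`-flux `∫₀^{2π} ⟪curl v(s)(r cos θ, r sin θ, z), e₃⟫ r dθ > 0` (the
circulation lever is not void). -/
def NonPlanarApex (v : ℝ → EuclideanSpace ℝ (Fin 3) → EuclideanSpace ℝ (Fin 3)) : Prop :=
  ∀ δ : ℝ, 0 < δ → ∃ s r z : ℝ, -δ ^ 2 < s ∧ s < 0 ∧ 0 < r ∧ r < δ ∧ |z| < δ ∧ 0 < ∫ θ in (0 : ℝ)..(2 * Real.pi), ⟪Literature.Analysis.FluidPDE.curl (v s) (WithLp.toLp 2 ![r * Real.cos θ, r * Real.sin θ, z] : EuclideanSpace ℝ (Fin 3)), (EuclideanSpace.single (2 : Fin 3) (1 : ℝ))⟫_ℝ * r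

/-- Statement of STUB 1 `stub_neckLength` (M; birth skeleton, verbatim): every profile of the route's energy class
satisfies `NeckBound`.  PROVED: `…Theorems.TiltDominationLoc.NeckLength.neckLength` (ns-el-k1b, p628658). -/
def StubNeckLength : Prop :=
  ∀ (C : ℝ) (v : ℝ → EuclideanSpace ℝ (Fin 3) → EuclideanSpace ℝ (Fin 3)) (π : ℝ → EuclideanSpace ℝ (Fin 3) → ℝ) (H : ℝ → EuclideanSpace ℝ (Fin 3) → EuclideanSpace ℝ (Fin 3) →L[ℝ] EuclideanSpace ℝ (Fin 3)), Literature.Analysis.FluidPDE.HasTypeITimeDecay C v → ContinuousOn (Function.uncurry v) (Set.Iio (0 : ℝ) ×ˢ Set.univ) → (∀ s t : ℝ, s < t → t < 0 → ∀ x, v t x = Literature.Analysis.UnboundedOperators.heatExtension (v s) (t - s) x - Literature.Analysis.FluidPDE.oseenDuhamel 1 s v v t x) → (∀ t < 0, Literature.Analysis.FluidPDE.VectorCalculus.IsDivFree (v t)) → Literature.Analysis.FluidPDE.IsSuitableWeakSolutionOn (Literature.Analysis.FluidPDE.slab (EuclideanSpace ℝ (Fin 3)) (Set.Iio (0 : ℝ))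 isOpen_Iio) 1 0 v π → Literature.Analysis.FluidPDE.HasWeakSpatialGradientOn (Literature.Analysis.FluidPDE.slab (EuclideanSpace ℝ (Fin 3)) (Set.Iio (0 : ℝ)) isOpen_Iio) v H → Literature.Analysis.FluidPDE.typeIBound (Set.Iio (0 : ℝ) ×ˢ Set.univ) v π H < ⊤ → NeckBound v

/-- Statement of STUB 0 `stub_noPlanarCollar` (L–XL, research; birth skeleton, verbatim): a one-signed, linearly growing,
backward-singular profile of the energy class has a NON-PLANAR APEX.  Equivalent to `PoloidalRigidity`
(`…TiltDominationLocRigidity.stubNoPlanarCollar_iff`). -/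
def StubNoPlanarCollar : Prop :=
  ∀ (C : ℝ) (v : ℝ → EuclideanSpace ℝ (Fin 3) → EuclideanSpace ℝ (Fin 3)) (π : ℝ → EuclideanSpace ℝ (Fin 3) → ℝ) (H : ℝ → EuclideanSpace ℝ (Fin 3) → EuclideanSpace ℝ (Fin 3) →L[ℝ] EuclideanSpace ℝ (Fin 3)), Literature.Analysis.FluidPDE.HasTypeITimeDecay C v → ContinuousOn (Function.uncurry v) (Set.Iio (0 : ℝ) ×ˢ Set.univ) → (∀ s t : ℝ, s < t → t < 0 → ∀ x, v t x = Literature.Analysis.UnboundedOperators.heatExtension (v s) (t - s) x - Literature.Analysis.FluidPDE.oseenDuhamel 1 s v v t x) → (∀ t < 0, Literature.Analysis.FluidPDE.VectorCalculus.IsDivFree (v t)) → Literature.Analysis.FluidPDE.IsSuitableWeakSolutionOn (Literature.Analysis.FluidPDE.slab (EuclideanSpace ℝ (Fin 3)) (Set.Iio (0 : ℝ)) isOpen_Iio) 1 0 v π → Literature.Analysis.FluidPDE.HasWeakSpatialGradientOn (Literature.Analysis.FluidPDE.slab (EuclideanSpace ℝ (Fin 3)) (Set.Iio (0 : ℝ))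 isOpen_Iio) v H → Literature.Analysis.FluidPDE.typeIBound (Set.Iio (0 : ℝ) ×ˢ Set.univ) v π H < ⊤ → (∀ s < 0, ∀ y, 0 ≤ ⟪Literature.Analysis.FluidPDE.curl (v s) y, (EuclideanSpace.single (2 : Fin 3) (1 : ℝ))⟫_ℝ) → (∃ K : ℝ, ∀ s < 0, ∀ (x : EuclideanSpace ℝ (Fin 3)) (R : ℝ), 0 < R → ∫⁻ y in Metric.ball x R, ENNReal.ofReal ⟪Literature.Analysis.FluidPDE.curl (v s) y, (EuclideanSpace.single (2 : Fin 3) (1 : ℝ))⟫_ℝ ≤ ENNReal.ofReal (K * R)) → Literature.Analysis.FluidPDE.IsBackwardSingularPoint v 0 → NonPlanarApex v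

/-- Statement of STUB 2 `stub_apexTiltOfNeckLoc` (XL, research; birth skeleton, verbatim): a backward-singular
one-signed linearly growing profile of the energy class with the neck bound and a non-planar apex is tilt-dominated
about its axis on some parabolic neighbourhood of the apex (the conclusion of `TiltDominationLoc`).  Equivalent to
`SingularIsPoloidal` (`…TiltDominationLocRigidity.stubApexTiltOfNeckLoc_iff`). -/
def StubApexTiltOfNeckLoc : Prop :=
  ∀ (C : ℝ) (v : ℝ → EuclideanSpace ℝ (Fin 3) → EuclideanSpace ℝ (Fin 3)) (π : ℝ → EuclideanSpace ℝ (Fin 3) → ℝ) (H : ℝ → EuclideanSpace ℝ (Fin 3) → EuclideanSpace ℝ (Fin 3) →L[ℝ] EuclideanSpace ℝ (Fin 3)), Literature.Analysis.FluidPDE.HasTypeITimeDecay C v → ContinuousOn (Function.uncurry v) (Set.Iio (0 : ℝ) ×ˢ Set.univ) → (∀ s t : ℝ, s < t → t < 0 → ∀ x, v t x = Literature.Analysis.UnboundedOperators.heatExtension (v s) (t - s) x - Literature.Analysis.FluidPDE.oseenDuhamel 1 s v v t x) → (∀ t < 0, Literature.Analysis.FluidPDE.VectorCalculus.IsDivFree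 (v t)) → Literature.Analysis.FluidPDE.IsSuitableWeakSolutionOn (Literature.Analysis.FluidPDE.slab (EuclideanSpace ℝ (Fin 3)) (Set.Iio (0 : ℝ)) isOpen_Iio) 1 0 v π → Literature.Analysis.FluidPDE.HasWeakSpatialGradientOn (Literature.Analysis.FluidPDE.slab (EuclideanSpace ℝ (Fin 3)) (Set.Iio (0 : ℝ)) isOpen_Iio) v H → Literature.Analysis.FluidPDE.typeIBound (Set.Iio (0 : ℝ) ×ˢ Set.univ) v π H < ⊤ → (∀ s < 0, ∀ y, 0 ≤ ⟪Literature.Analysis.FluidPDE.curl (v s) y, (EuclideanSpace.single (2 : Fin 3) (1 : ℝ))⟫_ℝ) → (∃ K : ℝ, ∀ s < 0, ∀ (x : EuclideanSpace ℝ (Fin 3)) (R : ℝ), 0 < R → ∫⁻ y in Metric.ball x R, ENNReal.ofReal ⟪Literature.Analysis.FluidPDE.curl (v s) y, (EuclideanSpace.single (2 : Fin 3) (1 : ℝ))⟫_ℝ ≤ ENNReal.ofReal (K * R)) → Literature.Analysis.FluidPDE.IsBackwardSingularPoint v 0 → NeckBound v → NonPlanarApex v → ∃ δ K M : ℝ,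 0 < δ ∧ 0 ≤ K ∧ 0 ≤ M ∧ ∀ s : ℝ, -δ ^ 2 < s → s < 0 → ∀ r : ℝ, 0 < r → r < δ → ∀ z : ℝ, |z| < δ → ∫ θ in (0 : ℝ)..(2 * Real.pi), ‖Literature.Analysis.FluidPDE.curl (v s) (WithLp.toLp 2 ![r * Real.cos θ, r * Real.sin θ, z] : EuclideanSpace ℝ (Fin 3)) - ⟪Literature.Analysis.FluidPDE.curl (v s) (WithLp.toLp 2 ![r * Real.cos θ, r * Real.sin θ, z] : EuclideanSpace ℝ (Fin 3)), (EuclideanSpace.single (2 : Fin 3) (1 : ℝ))⟫_ℝ • (EuclideanSpace.single (2 : Fin 3) (1 : ℝ))‖ * r ≤ K * (∫ θ in (0 : ℝ)..(2 * Real.pi), ⟪Literature.Analysis.FluidPDE.curl (v s) (WithLp.toLp 2 ![r * Real.cos θ, r * Real.sin θ, z] : EuclideanSpace ℝ (Fin 3)), (EuclideanSpace.single (2 : Fin 3) (1 : ℝ))⟫_ℝ * r) + M * r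

/-! ### §2 The rigidity dictionary's Props -/

/-- **ONE-SIGNED RIGIDITY** (the antecedent of the route item `RotationToAxis`, verbatim): no profile of the route's
energy class (Type-I rate, continuity on the open slab, unit-viscosity Oseen identity, divergence-free slices,
slab-suitable with a weak gradient and `𝐈 < ∞`) with `⟪curl v(s), e₃⟫ ≥ 0` everywhere and linear `e₃`-ball growth is
backward-singular at the apex `(0,0)`.  The one-signed ("half-space", Lei–Ren–Tian arXiv:2501.08976 Rem. 1.3)
Type-I Liouville statement in the energy class; `TiltDominationLoc ↔ OneSignedRigidity`.  OPEN. -/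
def OneSignedRigidity : Prop :=
  ∀ (C : ℝ) (v : ℝ → EuclideanSpace ℝ (Fin 3) → EuclideanSpace ℝ (Fin 3)) (π : ℝ → EuclideanSpace ℝ (Fin 3) → ℝ) (H : ℝ → EuclideanSpace ℝ (Fin 3) → EuclideanSpace ℝ (Fin 3) →L[ℝ] EuclideanSpace ℝ (Fin 3)), Literature.Analysis.FluidPDE.HasTypeITimeDecay C v → ContinuousOn (Function.uncurry v) (Set.Iio (0 : ℝ) ×ˢ Set.univ) → (∀ s t : ℝ, s < t → t < 0 → ∀ x, v t x = Literature.Analysis.UnboundedOperators.heatExtension (v s) (t - s) x - Literature.Analysis.FluidPDE.oseenDuhamel 1 s v v t x) → (∀ t < 0, Literature.Analysis.FluidPDE.VectorCalculus.IsDivFree (v t)) → Literature.Analysis.FluidPDE.IsSuitableWeakSolutionOn (Literature.Analysis.FluidPDE.slab (EuclideanSpace ℝ (Fin 3)) (Set.Iio (0 : ℝ)) isOpen_Iio) 1 0 v π → Literature.Analysis.FluidPDE.HasWeakSpatialGradientOn (Literature.Analysis.FluidPDE.slab (EuclideanSpace ℝ (Fin 3)) (Set.Iio (0 : ℝ)) isOpen_Iio)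 v H → Literature.Analysis.FluidPDE.typeIBound (Set.Iio (0 : ℝ) ×ˢ Set.univ) v π H < ⊤ → (∀ s < 0, ∀ y, 0 ≤ ⟪Literature.Analysis.FluidPDE.curl (v s) y, (EuclideanSpace.single (2 : Fin 3) (1 : ℝ))⟫_ℝ) → (∃ K : ℝ, ∀ s < 0, ∀ (x : EuclideanSpace ℝ (Fin 3)) (R : ℝ), 0 < R → ∫⁻ y in Metric.ball x R, ENNReal.ofReal ⟪Literature.Analysis.FluidPDE.curl (v s) y, (EuclideanSpace.single (2 : Fin 3) (1 : ℝ))⟫_ℝ ≤ ENNReal.ofReal (K * R)) → ¬ Literature.Analysis.FluidPDE.IsBackwardSingularPoint v 0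

/-- **POLOIDAL RIGIDITY in the energy class**: no profile of the route's energy class whose vertical vorticity
vanishes identically on the backward slab (`⟪curl v(s) y, e₃⟫ = 0` for all `s < 0`, `y`) is backward-singular at the
apex.  Implied by the shared crux `FilamentPinchDoor.PoloidalWindowRigidity` (item 19708, which assumes neither
suitability nor `𝐈 < ∞`); `StubNoPlanarCollar ↔ PoloidalRigidity`.  OPEN. -/
def PoloidalRigidity : Prop :=
  ∀ (C : ℝ) (v : ℝ → EuclideanSpace ℝ (Fin 3) → EuclideanSpace ℝ (Fin 3)) (π : ℝ → EuclideanSpace ℝ (Fin 3) → ℝ) (H : ℝ → EuclideanSpace ℝ (Fin 3) → EuclideanSpace ℝ (Fin 3) →L[ℝ] EuclideanSpace ℝ (Fin 3)), Literature.Analysis.FluidPDE.HasTypeITimeDecay C v → ContinuousOn (Function.uncurry v) (Set.Iio (0 : ℝ) ×ˢ Set.univ) → (∀ s t : ℝ, s < t → t < 0 → ∀ x, v t x = Literature.Analysis.UnboundedOperators.heatExtension (v s) (t - s) x - Literature.Analysis.FluidPDE.oseenDuhamel 1 s v v t x) → (∀ t < 0, Literature.Analysis.FluidPDE.VectorCalculus.IsDivFree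 (v t)) → Literature.Analysis.FluidPDE.IsSuitableWeakSolutionOn (Literature.Analysis.FluidPDE.slab (EuclideanSpace ℝ (Fin 3)) (Set.Iio (0 : ℝ)) isOpen_Iio) 1 0 v π → Literature.Analysis.FluidPDE.HasWeakSpatialGradientOn (Literature.Analysis.FluidPDE.slab (EuclideanSpace ℝ (Fin 3)) (Set.Iio (0 : ℝ)) isOpen_Iio) v H → Literature.Analysis.FluidPDE.typeIBound (Set.Iio (0 : ℝ) ×ˢ Set.univ) v π H < ⊤ → (∀ s < 0, ∀ y, ⟪Literature.Analysis.FluidPDE.curl (v s) y, (EuclideanSpace.single (2 : Fin 3) (1 : ℝ))⟫_ℝ = 0) → ¬ Literature.Analysis.FluidPDE.IsBackwardSingularPoint v 0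

/-- **A SINGULAR ONE-SIGNED PROFILE IS POLOIDAL**: a profile of the route's energy class with `⟪curl v(s), e₃⟫ ≥ 0`
everywhere and linear `e₃`-ball growth which IS backward-singular at the apex has `⟪curl v(s), e₃⟫ ≡ 0` on the whole
backward slab (equivalently — joint real-analyticity — on some parabolic neighbourhood of the apex).
`StubApexTiltOfNeckLoc ↔ SingularIsPoloidal`; `OneSignedRigidity ↔ PoloidalRigidity ∧ SingularIsPoloidal`.  OPEN. -/
def SingularIsPoloidal : Prop :=
  ∀ (C : ℝ) (v : ℝ → EuclideanSpace ℝ (Fin 3) → EuclideanSpace ℝ (Fin 3)) (π : ℝ → EuclideanSpace ℝ (Fin 3) → ℝ) (H : ℝ → EuclideanSpace ℝ (Fin 3) → EuclideanSpace ℝ (Fin 3) →L[ℝ] EuclideanSpace ℝ (Fin 3)), Literature.Analysis.FluidPDE.HasTypeITimeDecay C v → ContinuousOn (Function.uncurry v) (Set.Iio (0 : ℝ) ×ˢ Set.univ) → (∀ s t : ℝ, s < t → t < 0 → ∀ x, v t x = Literature.Analysis.UnboundedOperators.heatExtension (v s) (t - s) x - Literature.Analysis.FluidPDE.oseenDuhamel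 1 s v v t x) → (∀ t < 0, Literature.Analysis.FluidPDE.VectorCalculus.IsDivFree (v t)) → Literature.Analysis.FluidPDE.IsSuitableWeakSolutionOn (Literature.Analysis.FluidPDE.slab (EuclideanSpace ℝ (Fin 3)) (Set.Iio (0 : ℝ)) isOpen_Iio) 1 0 v π → Literature.Analysis.FluidPDE.HasWeakSpatialGradientOn (Literature.Analysis.FluidPDE.slab (EuclideanSpace ℝ (Fin 3)) (Set.Iio (0 : ℝ)) isOpen_Iio) v H → Literature.Analysis.FluidPDE.typeIBound (Set.Iio (0 : ℝ) ×ˢ Set.univ) v π H < ⊤ → (∀ s < 0, ∀ y, 0 ≤ ⟪Literature.Analysis.FluidPDE.curl (v s) y, (EuclideanSpace.single (2 : Fin 3) (1 : ℝ))⟫_ℝ) → (∃ K : ℝ, ∀ s < 0, ∀ (x : EuclideanSpace ℝ (Fin 3)) (R : ℝ), 0 < R → ∫⁻ y in Metric.ball x R, ENNReal.ofReal ⟪Literature.Analysis.FluidPDE.curl (v s) y, (EuclideanSpace.single (2 : Fin 3) (1 : ℝ))⟫_ℝ ≤ ENNReal.ofReal (K * R)) → Literature.Analysis.FluidPDE.IsBackwardSingularPoint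 v 0 → ∀ s < 0, ∀ y, ⟪Literature.Analysis.FluidPDE.curl (v s) y, (EuclideanSpace.single (2 : Fin 3) (1 : ℝ))⟫_ℝ = 0

end Summit.NavierStokesRegularity.NavierStokesRegularity.Theorems.AxisTwistDoorTiltDominationLocDefs

end
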